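import Summits.BirchSwinnertonDyer.BirchSwinnertonDyer.Theorems.PrintX10bResplitClosersCoherentPair
import HarnessLib
-- buildfix (bf3-g30) G30-80: comment-only touch to re-dispatch the lane build (dead-lettered rc 76 att 7 (19:06–19:45) behind Theorems.PrintX10bHowardContainmentLightFrameX10bOfMuCoherentPair, which was red after the PrintX10b closes re-key until my re-glue G30-74 p666040 (hub olean 20:43)); declarations byte-identical

set_option linter.dupNamespace false -- nested cell layout (D-0017)
set_option autoImplicit false

/-!
# PrintX10b — the H161 entry glue `HowardContainmentLightFrameX10bPinnedOfPrintOfHowardMu` holds (plan g12 turnkey)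

Closes the route item `Summit.BirchSwinnertonDyer.BirchSwinnertonDyer.Theses.PrintX10b.HowardContainmentLightFrameX10bPinnedOfPrintOfHowardMu`
(`MuInequalityCoherentPairOfHoward → HowardDVRKolyvaginBound → HowardContainmentLightFrameX10bPinnedOfPrint`) AT ONCE: modus ponens into the
landed chain 27275 ⟸ 22642 (p649419, `PrintX10bResplit.howardContainmentLightFrameX10bPinnedOfPrintOfCoherentPair_holds` with the leaf discharge
`printHypothesesDischargeX10b_holds`; the new crux's conclusion is item 22642's letter verbatim, `Iff.rfl`).  THEOREMS ONLY; no definition,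
no named fact, no `sorry`.
Propose: `ledger propose --kind proof --target Summits/BirchSwinnertonDyer/BirchSwinnertonDyer/Theorems/PrintX10bHowardMuEntry.lean
--file PrintX10bHowardMuEntry.lean --workitem <item id of HowardContainmentLightFrameX10bPinnedOfPrintOfHowardMu>`.
Honest framing: bookkeeping; Howard 2004 Thm. 1.6.1 stays a HYPOTHESIS (cite-only); no crux of substance is proved; BSD is NOT proved by this.
[cite: Howard2004HeegnerKolyvagin, Thm. 1.6.1] [cite: MastellaZerman2026, Cor. 4.6] [cite: CastellaGrossiLeeSkinner2022, Thm. 4.1.1]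
[cite: CastellaGrossiSkinner2025, Thm. 6.5.2]
-/

namespace Summit.BirchSwinnertonDyer.BirchSwinnertonDyer.Theorems.PrintX10bHowardMuEntry

open Summit.BirchSwinnertonDyer.BirchSwinnertonDyer.Theses.PrintX10b

/-- **The H161 entry glue of PrintX10b holds** (one line over p649419). [cite: Howard2004HeegnerKolyvagin, Thm. 1.6.1] -/
theorem howardContainmentLightFrameX10bPinnedOfPrintOfHowardMu_holds :
    HowardContainmentLightFrameX10bPinnedOfPrintOfHowardMu :=
  fun hM hH =>
    Summit.BirchSwinnertonDyer.BirchSwinnertonDyer.Theorems.PrintX10bResplit.howardContainmentLightFrameX10bPinnedOfPrintOfCoherentPair_holds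
      (hM hH) Summit.BirchSwinnertonDyer.BirchSwinnertonDyer.Theorems.PrintX10bResplit.printHypothesesDischargeX10b_holds

end Summit.BirchSwinnertonDyer.BirchSwinnertonDyer.Theorems.PrintX10bHowardMuEntry
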